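import Literature.AnabelianGeometry.SemiGraphs.ArithDecompositionData
import HarnessLib

/-!
# [SemiAnbd] Thm 5.4: the generic carrier `DecompositionData.ofGraph` and the two explicit hypothesis
# packages `ArithLevelData` (the arithmetic tree/level system) and `ArithChartAction` (Def 5.1 (i) on the chart)

Mochizuki, *Semi-graphs of anabelioids*, Publ. RIMS **42** (2006), §5 pp. 62–66 (Def 5.1 (i),
Prop 5.2 (iv), p. 65, Thm 5.4), kurims `paper:url-f33ace170ff4`. [cite: MochizukiSemiAnbd2006, Thm 5.4, p. 66]

Second STATEMENTS file of sub-DAG `plan/L3/SUBDAG-SemiAnbd-Thm54.md` row T54-0 (PRODUCER), rulings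
abc-iut-L3-lead gen 2 (2026-08-25T23:51:59Z (S1)/(S2)) and gen 3 (α3-4): over abc-iut-L3-t3's
`DecompositionData` (ArithMaximalCompact.lean) and abc-iut-w4-d053's `ArithDecompositionData.lean`:

* (S1) `DecompositionData.ofGraph 𝔾 vertGp brGp hle` — the GENERIC CARRIER over a semi-graph `𝔾`
  (vertices, branches, edges, abutment = those of `𝔾`; abc-iut-w4-d059's shape): every T54 row states
  its theorem over it; `decompositionDataOfChart_eq_ofGraph` records that the chart-produced data of
  `ArithDecompositionData.lean` IS `ofGraph` of the underlying semi-graph with the commensurator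
  decomposition groups of p. 65 (so rows specialise to it by `rw`).
* (S2a) `ArithLevelData 𝔾 D aug baseAct` — the ARITHMETIC LEVEL DATA: the twin of abc-iut-L3-t10/t11's
  `VerticialLevelData` + `FiniteLevelData` (TemperedLevelData.lean; [SemiAnbd] proof of Thm 3.7 (iii)
  p. 41 with the author's Comments (6)) with `π₁^temp(𝒢) ↦ Gtp = Π^temp_𝔊`: a directed system of trees
  `T_j` (universal graph-coverings of the finite levels `𝔾_j` of the Galois tower of `B^temp(𝔊)`) with
  `Gtp`-actions covering the ARITHMETIC action `baseAct ∘ aug` of `Π^temp_𝔊` on `𝔾` through `Π_A`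
  (Def 5.1 (i); the geometric tower acts OVER `𝔾`, the arithmetic one does not), the printed hypothesis
  of Thm 5.4 "the arithmetic actions on the underlying graphs … do not switch the branches of any edge"
  as t3's `NoBranchSwitching` ON `baseAct` (its tree-level form is DERIVED, `ArithLevelData.noSwap`),
  and the dictionary clauses (AI1)/(AI2) `fix` (two-sided: verticial subgroup = stabiliser of a
  compatible vertex system), (AI3) `edge` (two-sided: edge-like subgroup = stabiliser of an eventual
  compatible edge system — the DEFINITION of the decomposition group of a branch), (AI4′)
  `stabBranchPair` (estrangement-shaped, abc-iut-w4-d059/d029's `hdict`): EXACTLY the loose binders of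
  the T54-3 files (w4-d059 `arithMaximalCompactStatementI_of_levelData` p413068, w4-d029
  `hstar_of_isArithAmple`), packaged.  A HYPOTHESIS PACKAGE (binders; nothing asserted, no instance):
  producing it from Prop 5.2 (iv) + the Galois tower is the booked producer-debt row T54-B
  (plan/GAP-LEDGER.md G-w4d053-1).
* (S2b) `ArithChartAction 𝒢 c ι aug actV actB` — Def 5.1 (i) seen on the tempered chart: the action of
  `Π_A` on vertices/branches of the underlying semi-graph, the compatibility "conjugation by `g ∈ Π^temp_𝔊`
  carries the §3 verticial (edge-like) subgroups at `v` (`e`) onto those at `(aug g) • v` (`(aug g) • e`)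
  through `ι`" (Prop 3.6 (iv) at the automorphism `ρ(aug g)`), and Def 5.1 (i)(c) "some open subgroup of
  `Π_A` acts trivially on the underlying semi-graph".  Again a hypothesis package; the binders
  `hex : ι.range = aug.ker`, `hsurj : Function.Surjective aug` (Prop 5.2 (iv)) travel separately.

Nothing here asserts a statement of the paper; typed ≠ proved; no side taken on [IUTchIII] Cor 3.12.
-/

namespace Literature.AnabelianGeometry.SemiGraphs

open CategoryTheory Topology
open scoped Pointwise

universe v u u' u''

/-! ### (S1) The generic carrier over a semi-graph -/

/-- **The generic carrier** (ruling S1, abc-iut-w4-d059's shape): the `DecompositionData` over a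
semi-graph `𝔾` with given vertex and branch groups — vertices, branches, edges and abutment are those
of `𝔾`. [cite: MochizukiSemiAnbd2006, §5, p. 65] -/
def DecompositionData.ofGraph {Gtp : Type u'} [Group Gtp] (𝔾 : SemiGraph.{u})
    (vertGp : 𝔾.Vertex → Subgroup Gtp) (brGp : 𝔾.Branch → Subgroup Gtp)
    (hle : ∀ (b : 𝔾.Branch) (v : 𝔾.Vertex), 𝔾.abuts b = some v → brGp b ≤ vertGp v) :
    DecompositionData Gtp 𝔾.Vertex 𝔾.Branch where
  E := 𝔾.Edge
  edgeOf := 𝔾.edgeOf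
  abut := 𝔾.abuts
  vertGp := vertGp
  brGp := brGp
  brGp_le_vertGp := hle

namespace ProfiniteSemiGraph

variable {𝒢 : ProfiniteSemiGraph.{u}} {c : TemperedPiChart 𝒢} {Gtp : Type u'} [Group Gtp]

/-- The chart-produced data of `ArithDecompositionData.lean` IS the generic carrier over the underlying
semi-graph with the commensurator decomposition groups of p. 65 (ruling S1: "`ofChart` defined through
`ofGraph`" — a definitional equation). [cite: MochizukiSemiAnbd2006, §5, p. 65] -/
theorem decompositionDataOfChart_eq_ofGraph (R : ChartRepresentatives c) (ι : c.G →* Gtp) :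
    decompositionDataOfChart R ι =
      DecompositionData.ofGraph 𝒢.graph (arithVertGp R ι) (arithBrGp R ι)
        (fun _ _ h => arithBrGp_le_arithVertGp R ι h) := rfl

end ProfiniteSemiGraph

/-! ### (S2a) Arithmetic level data -/

/-- **Arithmetic level data for [SemiAnbd] Thm 5.4** (ruling S2; abc-iut-w4-d059's (L0)(L1)(AI1)–(AI3),
(AI4′)): for a semi-graph `𝔾`, decomposition data `D` over it (typically `DecompositionData.ofGraph 𝔾 …`),
an augmentation `aug : Gtp → Π_A` and the arithmetic action `baseAct : Π_A → Aut 𝔾` of Def 5.1 (i) — the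
twin, with `π₁^temp(𝒢)` replaced by `Gtp = Π^temp_𝔊`, of `ProfiniteSemiGraph.VerticialLevelData` /
`FiniteLevelData` (TemperedLevelData.lean; proof of Thm 3.7 (iii) p. 41 and the author's Comments (6)):
(L0) a nonempty directed system of trees `T_j` with `Gtp`-actions with open kernels, functorial
equivariant transitions over `𝔾`, finite levels `𝔾_j` with immersions `T_j → 𝔾_j`, induced actions and
transitions; (L1) the actions COVER the arithmetic action on `𝔾` (`act_proj`) and "the arithmetic actions
… do not switch the branches of any edge" (Thm 5.4 p. 66) for `baseAct` (`noSwitchBase`, t3's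
`NoBranchSwitching`); (AI1)+(AI2) `fix`/`stab`: verticial subgroups (`IsVerticial D`) are exactly the
stabilisers of compatible vertex systems (both directions, both two-sided); (AI3) `edge`/`edgeFix`: edge-like
subgroups (`IsEdgeLike D`) are exactly the stabilisers of eventual compatible edge systems (edges with
their branches; `edgeFix` records the two end-vertex systems); (AI4′) `stabBranchPair`:
the stabiliser of a compatible finite-level branch-pair system lies in a conjugate
`x · (Π_b ∩ h Π_{b'} h⁻¹) · x⁻¹` with `b, b'` abutting to one vertex `v`, `h ∈ Π_v`, `b' ≠ b ∨ h ∉ Π_b`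
(Remark 2.2.1 at branch level, estrangement-shaped).  A HYPOTHESIS PACKAGE: nothing is asserted; its
production from Prop 5.2 (iv) and the Galois tower of `B^temp(𝔊)` is producer debt (row T54-B).
[cite: MochizukiSemiAnbd2006, Thm 5.4 (i), p. 66] -/
structure ArithLevelData {Gtp : Type u'} [Group Gtp] [TopologicalSpace Gtp] {PA : Type u''} [Group PA]
    (𝔾 : SemiGraph.{u}) (D : DecompositionData Gtp 𝔾.Vertex 𝔾.Branch) (aug : Gtp →* PA)
    (baseAct : PA →* Aut 𝔾) : Type (max (u + 1) u' (v + 1)) where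
  /-- the index set of levels (a cofinal system of finite étale Galois coverings `𝔊_j → 𝔊`) -/
  J : Type v
  [preorder : Preorder J]
  [isDirected : IsDirectedOrder J]
  [nonempty : Nonempty J]
  /-- the trees `T_j` (universal graph-coverings of the finite levels) -/
  tree : J → SemiGraph.{u}
  /-- each `T_j` is a tree -/
  isTree : ∀ j, (tree j).IsTree
  /-- each `T_j` has a vertex -/
  vertex : ∀ j, (tree j).Vertex
  /-- the structure morphisms `T_j → 𝔾` -/
  proj : ∀ j, tree j ⟶ 𝔾
  /-- the actions `Π^temp_𝔊 → Aut T_j` -/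
  act : ∀ j, Gtp →* Aut (tree j)
  /-- the actions factor through finite quotients: open kernels -/
  isOpen_ker : ∀ j, IsOpen ((act j).ker : Set Gtp)
  /-- (L1) the actions COVER the arithmetic action of `Π^temp_𝔊` on `𝔾` through `Π_A` (Def 5.1 (i)) -/
  act_proj : ∀ (j : J) (g : Gtp), (act j g).hom ≫ proj j = proj j ≫ (baseAct (aug g)).hom
  /-- Thm 5.4, frame hypothesis: "the arithmetic actions on the underlying graphs … do not switch the
  branches of any edge" (for `baseAct`, t3's `NoBranchSwitching`) -/
  noSwitchBase : NoBranchSwitching 𝔾.edgeOf (fun (a : PA) (b : 𝔾.Branch) => (baseAct a).hom.branchMap b)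
  /-- the transition morphisms `T_j → T_i`, `i ≤ j` -/
  trans : ∀ ⦃i j : J⦄, i ≤ j → (tree j ⟶ tree i)
  /-- functoriality: identities -/
  trans_id : ∀ j, trans (le_refl j) = 𝟙 (tree j)
  /-- functoriality: composition -/
  trans_comp : ∀ ⦃i j k : J⦄ (hij : i ≤ j) (hjk : j ≤ k), trans hjk ≫ trans hij = trans (hij.trans hjk)
  /-- the transition morphisms are over `𝔾` -/
  trans_over : ∀ ⦃i j : J⦄ (h : i ≤ j), trans h ≫ proj i = proj j
  /-- the transition morphisms are equivariant -/
  trans_act : ∀ ⦃i j : J⦄ (h : i ≤ j) (g : Gtp), (act j g).hom ≫ trans h = trans h ≫ (act i g).hom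
  /-- (AI1)+(AI2), two-sided: the verticial subgroups of `D` are exactly the stabilisers of compatible
  systems of tree vertices -/
  fix : ∀ W : Subgroup Gtp, IsVerticial D W → ∃ x : ∀ j, (tree j).Vertex,
    (∀ ⦃i j : J⦄ (h : i ≤ j), (trans h).vertexMap (x j) = x i) ∧
      ∀ g : Gtp, g ∈ W ↔ ∀ j, (act j g).hom.vertexMap (x j) = x j
  /-- (AI2), two-sided (abc-iut-w4-d059's `hstab`, p413677): the full stabiliser of every compatible
  system of tree vertices IS a verticial subgroup of `D` -/
  stab : ∀ x : ∀ j, (tree j).Vertex, (∀ ⦃i j : J⦄ (h : i ≤ j), (trans h).vertexMap (x j) = x i) →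
    ∃ W : Subgroup Gtp, IsVerticial D W ∧ ∀ g : Gtp, g ∈ W ↔ ∀ j, (act j g).hom.vertexMap (x j) = x j
  /-- (AI3), two-sided: the stabiliser of an eventual compatible system of edges (with their branches)
  is an edge-like subgroup of `D` (the decomposition group of a branch IS such a stabiliser) -/
  edge : ∀ (j₁ : J) (ε : ∀ j : {j : J // j₁ ≤ j}, (tree j.1).Edge),
    (∀ ⦃i j : {j : J // j₁ ≤ j}⦄ (h : i.1 ≤ j.1), (trans h).edgeMap (ε j) = ε i) →
    ∃ L : Subgroup Gtp, IsEdgeLike D L ∧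
      ∀ g : Gtp, g ∈ L ↔ ∀ j, (act j.1 g).hom.edgeMap (ε j) = ε j ∧
        ∀ b : (tree j.1).Branch, (tree j.1).edgeOf b = ε j → (act j.1 g).hom.branchMap b = b
  /-- (AI3), converse direction (abc-iut-w4-d059's `hedgeFix`, p413677): every edge-like subgroup of `D`
  IS the full stabiliser of an eventual compatible system of tree edges (with their branches), given
  with its two compatible, level-wise distinct end-vertex systems -/
  edgeFix : ∀ L : Subgroup Gtp, IsEdgeLike D L →
    ∃ (i : J) (ε : ∀ j : {j : J // i ≤ j}, (tree j.1).Edge) (c c' : ∀ j : {j : J // i ≤ j}, (tree j.1).Branch)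
      (x₁ x₂ : ∀ j, (tree j).Vertex),
      (∀ ⦃i' j : J⦄ (h : i' ≤ j), (trans h).vertexMap (x₁ j) = x₁ i') ∧
      (∀ ⦃i' j : J⦄ (h : i' ≤ j), (trans h).vertexMap (x₂ j) = x₂ i') ∧
      (∀ j, x₁ j.1 ≠ x₂ j.1 ∧ (tree j.1).edgeOf (c j) = ε j ∧ (tree j.1).edgeOf (c' j) = ε j ∧
        (tree j.1).abuts (c j) = some (x₁ j.1) ∧ (tree j.1).abuts (c' j) = some (x₂ j.1)) ∧
      ∀ g : Gtp, g ∈ L ↔ ∀ j, (act j.1 g).hom.edgeMap (ε j) = ε j ∧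
        ∀ b : (tree j.1).Branch, (tree j.1).edgeOf b = ε j → (act j.1 g).hom.branchMap b = b
  /-- the finite semi-graphs `𝔾_j` underlying the finite étale Galois coverings `𝔊_j → 𝔊` -/
  level : J → SemiGraph.{u}
  [finiteVertex : ∀ j, Finite (level j).Vertex]
  [finiteBranch : ∀ j, Finite (level j).Branch]
  /-- the universal graph-coverings `T_j → 𝔾_j` -/
  quot : ∀ j, tree j ⟶ level j
  /-- graph-coverings are immersions -/
  quot_isImmersion : ∀ j, SemiGraph.IsImmersion (quot j)
  /-- the induced actions on the finite levels -/
  levelAct : ∀ j, Gtp →* Aut (level j)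
  /-- `quot` is equivariant -/
  act_quot : ∀ (j : J) (g : Gtp), (act j g).hom ≫ quot j = quot j ≫ (levelAct j g).hom
  /-- the transition morphisms `𝔾_j → 𝔾_i`, `i ≤ j` -/
  levelTrans : ∀ ⦃i j : J⦄, i ≤ j → (level j ⟶ level i)
  /-- functoriality: identities -/
  levelTrans_id : ∀ j, levelTrans (le_refl j) = 𝟙 (level j)
  /-- functoriality: composition -/
  levelTrans_comp : ∀ ⦃i j k : J⦄ (hij : i ≤ j) (hjk : j ≤ k),
    levelTrans hjk ≫ levelTrans hij = levelTrans (hij.trans hjk)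
  /-- the finite-level transition morphisms are equivariant -/
  levelTrans_act : ∀ ⦃i j : J⦄ (h : i ≤ j) (g : Gtp),
    (levelAct j g).hom ≫ levelTrans h = levelTrans h ≫ (levelAct i g).hom
  /-- the transition morphisms of the trees cover those of the finite levels -/
  trans_quot : ∀ ⦃i j : J⦄ (h : i ≤ j), trans h ≫ quot i = quot j ≫ levelTrans h
  /-- (AI4′) Remark 2.2.1 at branch level, arithmetic twin (abc-iut-w4-d059/d029's `hdict`): the
  stabiliser of a compatible finite-level branch-pair system lies in a conjugate of
  `Π_b ∩ h Π_{b'} h⁻¹`, `b, b'` abutting to one vertex `v`, `h ∈ Π_v`, `b' ≠ b ∨ h ∉ Π_b` -/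
  stabBranchPair : ∀ (j₀ : J) (w : ∀ i : {i : J // j₀ ≤ i}, (level i.1).Vertex)
    (β β' : ∀ i : {i : J // j₀ ≤ i}, (level i.1).Branch),
    (∀ i, β i ≠ β' i ∧ (level i.1).abuts (β i) = some (w i) ∧ (level i.1).abuts (β' i) = some (w i)) →
    (∀ ⦃i i' : {i : J // j₀ ≤ i}⦄ (h : i.1 ≤ i'.1), (levelTrans h).vertexMap (w i') = w i ∧
      (levelTrans h).branchMap (β i') = β i ∧ (levelTrans h).branchMap (β' i') = β' i) →
    ∃ (v : 𝔾.Vertex) (b b' : 𝔾.Branch) (x h : Gtp), D.abut b = some v ∧ D.abut b' = some v ∧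
      h ∈ D.vertGp v ∧ (b' ≠ b ∨ h ∉ D.brGp b) ∧
      ∀ g : Gtp, (∀ i, (levelAct i.1 g).hom.vertexMap (w i) = w i ∧
        (levelAct i.1 g).hom.branchMap (β i) = β i ∧ (levelAct i.1 g).hom.branchMap (β' i) = β' i) →
        g ∈ conjSubgroup x (D.brGp b ⊓ conjSubgroup h (D.brGp b'))

namespace ArithLevelData

attribute [instance] ArithLevelData.preorder ArithLevelData.isDirected ArithLevelData.nonempty
  ArithLevelData.finiteVertex ArithLevelData.finiteBranch

variable {Gtp : Type u'} [Group Gtp] [TopologicalSpace Gtp] {PA : Type u''} [Group PA]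
  {𝔾 : SemiGraph.{u}} {D : DecompositionData Gtp 𝔾.Vertex 𝔾.Branch} {aug : Gtp →* PA}
  {baseAct : PA →* Aut 𝔾} (L : ArithLevelData.{v} 𝔾 D aug baseAct)

/-- Pointwise equivariance of the tree transitions (the binder `hequiv` of abc-iut-w4-d059's T54-3 file).
[cite: MochizukiSemiAnbd2006, Thm 5.4 (i), p. 66] -/
theorem trans_act_vertexMap ⦃i j : L.J⦄ (h : i ≤ j) (g : Gtp) (x : (L.tree j).Vertex) :
    (L.trans h).vertexMap ((L.act j g).hom.vertexMap x) =
      (L.act i g).hom.vertexMap ((L.trans h).vertexMap x) := by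
  have := congrArg (fun φ : L.tree j ⟶ L.tree i => φ.vertexMap x) (L.trans_act h g)
  simpa using this

/-- **No branch switching at tree level, DERIVED** from the printed hypothesis on the base graph
(`noSwitchBase`) and `act_proj`: if `g` fixes the edge of the branch `b'` of `T_j`, then `aug g` fixes the
edge of `proj b'` in `𝔾`, hence fixes `proj b'` (no switching downstairs), hence `g` fixes `b'` since a
morphism of semi-graphs is injective on the branches of each edge (`branchMap_injOn`).  This is the
binder `hnoswap` of abc-iut-w4-d059's T54-3 file. [cite: MochizukiSemiAnbd2006, Thm 5.4, p. 66] -/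
theorem noSwap (j : L.J) (g : Gtp) (b' : (L.tree j).Branch)
    (he : (L.act j g).hom.edgeMap ((L.tree j).edgeOf b') = (L.tree j).edgeOf b') :
    (L.act j g).hom.branchMap b' = b' := by
  -- the moved branch lies on the same edge
  have hedge : (L.tree j).edgeOf ((L.act j g).hom.branchMap b') = (L.tree j).edgeOf b' := by
    rw [(L.act j g).hom.edgeOf_branchMap, he]
  -- downstairs: `proj (g • b') = (aug g) • proj b'`
  have hproj : (L.proj j).branchMap ((L.act j g).hom.branchMap b') =
      (baseAct (aug g)).hom.branchMap ((L.proj j).branchMap b') := by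
    have := congrArg (fun φ : L.tree j ⟶ 𝔾 => φ.branchMap b') (L.act_proj j g)
    simpa using this
  -- `aug g` fixes the edge of `proj b'`, hence `proj b'` itself (no switching on the base graph)
  have hbase : (baseAct (aug g)).hom.branchMap ((L.proj j).branchMap b') = (L.proj j).branchMap b' := by
    apply L.noSwitchBase (aug g)
    change 𝔾.edgeOf ((baseAct (aug g)).hom.branchMap ((L.proj j).branchMap b')) =
      𝔾.edgeOf ((L.proj j).branchMap b')
    rw [← hproj, (L.proj j).edgeOf_branchMap, (L.proj j).edgeOf_branchMap, hedge]
  -- injectivity of `proj` on the branches of one edge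
  exact (L.proj j).branchMap_injOn _ _ hedge (by rw [hproj, hbase])

end ArithLevelData

/-! ### (S2b) The arithmetic action seen on the tempered chart (Def 5.1 (i)) -/

namespace ProfiniteSemiGraph

variable {𝒢 : ProfiniteSemiGraph.{u}}

/-- **The arithmetic action on the tempered chart** (Def 5.1 (i) `ρ : π̂₁(A) → Aut(𝔾)` seen through
Prop 3.6 (iv) and the inclusion `ι : Π^temp_𝔾 = c.G → Π^temp_𝔊 = Gtp`, Prop 5.2 (iv)): `Π_A` acts on the
vertices, edges and branches of the underlying semi-graph compatibly with `edgeOf`/`abuts`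
(`actV`, `actE`, `actB`); conjugation by `g ∈ Π^temp_𝔊` carries the image of every §3 verticial subgroup at
`v` (resp. edge-like subgroup at `e`) to the image of a verticial subgroup at `(aug g) • v` (resp. an
edge-like subgroup at `(aug g) • e`) — "the decomposition groups are well-defined up to conjugation in
`Π^temp_𝔊`" (p. 65) — and Def 5.1 (i)(c): "the action of [some open subgroup] `H` on the underlying
semi-graph is trivial".  A HYPOTHESIS PACKAGE (binders); producing it is row T54-B
(plan/GAP-LEDGER.md G-w4d053-1). [cite: MochizukiSemiAnbd2006, Def 5.1 (i), p. 62] -/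
structure ArithChartAction (c : TemperedPiChart 𝒢) {Gtp : Type u'} [Group Gtp] (ι : c.G →* Gtp)
    {PA : Type u''} [Group PA] [TopologicalSpace PA] (aug : Gtp →* PA)
    (actV : PA → 𝒢.graph.Vertex → 𝒢.graph.Vertex) (actE : PA → 𝒢.graph.Edge → 𝒢.graph.Edge)
    (actB : PA → 𝒢.graph.Branch → 𝒢.graph.Branch) : Prop where
  /-- the action on branches lies over the action on edges -/
  edgeOf_actB : ∀ (a : PA) (b : 𝒢.graph.Branch), 𝒢.graph.edgeOf (actB a b) = actE a (𝒢.graph.edgeOf b)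
  /-- the action on branches lies over the action on vertices -/
  abuts_actB : ∀ (a : PA) (b : 𝒢.graph.Branch) (v : 𝒢.graph.Vertex),
    𝒢.graph.abuts b = some v → 𝒢.graph.abuts (actB a b) = some (actV a v)
  /-- conjugation by `g ∈ Π^temp_𝔊` carries verticial subgroups at `v` to verticial subgroups at
  `(aug g) • v`, through `ι` (Prop 3.6 (iv) at `ρ(aug g)`) -/
  conj_verticial : ∀ (g : Gtp) (v : 𝒢.graph.Vertex) (H : Subgroup c.G), H ∈ verticialSubgroups c v →
    ∃ H' ∈ verticialSubgroups c (actV (aug g) v), conjSubgroup g (H.map ι) = H'.map ι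
  /-- … and edge-like subgroups at `e` to edge-like subgroups at `(aug g) • e` -/
  conj_edgeLike : ∀ (g : Gtp) (e : 𝒢.graph.Edge) (K : Subgroup c.G), K ∈ edgeLikeSubgroups c e →
    ∃ K' ∈ edgeLikeSubgroups c (actE (aug g) e), conjSubgroup g (K.map ι) = K'.map ι
  /-- Def 5.1 (i)(c): some open subgroup of `Π_A` acts trivially on the underlying semi-graph -/
  exists_open_trivial : ∃ U : Subgroup PA, IsOpen (U : Set PA) ∧
    ∀ a ∈ U, (∀ v, actV a v = v) ∧ (∀ e, actE a e = e) ∧ ∀ b, actB a b = b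

end ProfiniteSemiGraph

end Literature.AnabelianGeometry.SemiGraphs
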